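import Literature.Analysis.FluidPDE.LocalLerayPressureDecompositionHolds
import Literature.Analysis.FluidPDE.LocalLerayPressureDecompositionProofs
import Literature.Analysis.FluidPDE.LerayPressureDecayProofs
import Mathlib.Analysis.MeanInequalitiesPow
import HarnessLib

/-!
# Seregin's Lemma B.6: the near-field pressure with the cut-off (B.2.14)–(B.2.16)

Analysis/FluidPDE proof file (theorems only) on the discharge path of
`Literature.Analysis.FluidPDE.seregin2014_limit_decay` (Seregin 2014, App. B, Lemma B.6). In
the proof of Lemma B.6 (PDF pp. 154–155) the near part `p¹_{x₀}` of the local pressure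
expansion, multiplied by the cut-off `χ_R`, is decomposed as `χ_R p¹_{x₀} = q₁ + q₂` with
`q₂ = (1/4π)∫_{B(x₀,2)} K(x−y) χ_R(y) : v ⊗ v dy` and `q₁ = −χ_R|v|²/3 +
(1/4π)∫ K(x−y)(χ_R(x) − χ_R(y)) : v ⊗ v dy`, the latter split once more through
`χ_R(x) − χ_R(y) = (χ_R(x) − χ_R(x₀)) + (χ_R(x₀) − χ_R(y))`; "the theory of singular
integrals" then gives (B.2.15)–(B.2.16). Here the same algebra is carried out for the tree's
Riesz-transform pressure `p̃[w] = normalisedPressure w` (`= −|w|²/3 + p.v.∫K(x−y)(w(y))dy`) by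
passing the (signed, `y`-dependent) weights inside the quadratic slot of the kernel
(`K(z)(c • a) = c² K(z)(a)`): with `c(y) = χ(x₀) − χ(y) = c₊(y) − c₋(y)`, the fields
`√χ • w`, `√c₊ • w`, `√c₋ • w`, and at every point where the four principal values exist,

`χ(x) p̃[w](x) = p̃[√χ w](x) + (χ(x) − χ(x₀))(p̃[w](x) + |w(x)|²/3)
  + (p̃[√c₊ w](x) + c₊(x)|w(x)|²/3) − (p̃[√c₋ w](x) + c₋(x)|w(x)|²/3)`

(`normalisedPressure_weight_identity`), so that no commutator integral is needed: every term is
a Riesz pressure, bounded in `L^{3/2}` by the tree's Calderón–Zygmund bound **CZ**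
(`stein1970_normalisedPressure_ae_Lp_bound_holds`), or a local term. The outcome is the slice
bound

* `lintegral_cutoff_mul_localPressureNear_rpow_le` —
  `∫_{B(x₀,3/2)} |χ p_near|^{3/2} ≤ C (∫_{B(x₀,4)} χ^{3/2}|v|³ + L^{3/2} ∫_{B(x₀,4)} |v|³)`
  for `p_near = localPressureNear x₀ 2 v t` and any weight `χ` with `0 ≤ χ ≤ 1`,
  `|χ(x) − χ(y)| ≤ L|x − y|` — Seregin's (B.2.15)–(B.2.16) with `χ = χ_R`, `L = c/R`.

## References

* G. Seregin, *Lecture Notes on Regularity Theory for the Navier–Stokes Equations* (2014),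
  doi:10.1142/9314, App. B, proof of Lemma B.6, (B.2.14)–(B.2.16), PDF pp. 154–155. Bib key
  `Seregin2014`.
* E. M. Stein, *Singular integrals and differentiability properties of functions* (1970),
  Ch. II §4.2 Thm. 3 (the `L^p` bound). Bib key `Stein1971`.
-/

noncomputable section

open MeasureTheory TopologicalSpace Set Function Filter Metric
open _root_.Topology
open scoped ENNReal NNReal RealInnerProductSpace

namespace Literature.Analysis.FluidPDE

/-! ### Slices of the Riesz pressure are measurable -/

/-- For a measurable square-integrable field `w`, `x ↦ p̃[w](x)` is a.e.-strongly measurable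
(a strongly measurable modification `w̃` of `w` has a strongly measurable Riesz pressure by
`exists_stronglyMeasurable_normalisedPressure_eq`, and `p̃[w] = p̃[w̃]` wherever `w = w̃`).
[folklore] -/
theorem aestronglyMeasurable_normalisedPressure_of_sq_integrable
    {w : EuclideanSpace ℝ (Fin 3) → EuclideanSpace ℝ (Fin 3)} (hw : AEStronglyMeasurable w volume)
    (hw2 : Integrable (fun y => ‖w y‖ ^ 2) volume) :
    AEStronglyMeasurable (normalisedPressure w) volume := by
  set wt := hw.mk w with hwt
  have hwtm : StronglyMeasurable wt := hw.stronglyMeasurable_mk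
  have hae : w =ᵐ[volume] wt := hw.ae_eq_mk
  set U : ℝ → EuclideanSpace ℝ (Fin 3) → EuclideanSpace ℝ (Fin 3) := fun _ => wt with hU
  have hUm : StronglyMeasurable (uncurry U) := hwtm.comp_measurable measurable_snd
  have hint : ∀ t ∈ (univ : Set ℝ), Integrable (fun y => ‖U t y‖ ^ 2) volume := by
    intro t _
    refine hw2.congr ?_
    filter_upwards [hae] with y hy
    simp [hU, hy]
  obtain ⟨g, hgm, hg⟩ := exists_stronglyMeasurable_normalisedPressure_eq hUm hint
  have hgx : StronglyMeasurable fun x : EuclideanSpace ℝ (Fin 3) => g (0, x) :=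
    hgm.comp_measurable (measurable_const.prodMk measurable_id)
  refine ⟨fun x => g (0, x), hgx, ?_⟩
  filter_upwards [hae] with x hx
  show normalisedPressure w x = g (0, x)
  rw [← hg 0 (mem_univ _) x]
  exact normalisedPressure_congr_ae hae hx

/-! ### Weights inside the quadratic slot -/

/-- Truncated integrals of `√c • w` for a nonnegative weight: `T_ε[√c w](x) = ∫ c K(x−·)(w)`.
[folklore] -/
theorem truncatedPressureIntegral_sqrt_smul
    (w : EuclideanSpace ℝ (Fin 3) → EuclideanSpace ℝ (Fin 3)) {c : EuclideanSpace ℝ (Fin 3) → ℝ}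
    (hc : ∀ y, 0 ≤ c y) (x : EuclideanSpace ℝ (Fin 3)) (ε : ℝ) :
    truncatedPressureIntegral (fun y => Real.sqrt (c y) • w y) x ε =
      ∫ y in (closedBall x ε)ᶜ, c y * pressureKernel (x - y) (w y) := by
  simp only [truncatedPressureIntegral, pressureKernel_smul_right, Real.sq_sqrt (hc _)]

/-- The truncated integrand of `√c • w` is `c · (K(x−·)(w))`. [folklore] -/
theorem pressureKernel_sqrt_smul
    (w : EuclideanSpace ℝ (Fin 3) → EuclideanSpace ℝ (Fin 3)) {c : EuclideanSpace ℝ (Fin 3) → ℝ}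
    (hc : ∀ y, 0 ≤ c y) (x y : EuclideanSpace ℝ (Fin 3)) :
    pressureKernel (x - y) (Real.sqrt (c y) • w y) = c y * pressureKernel (x - y) (w y) := by
  rw [pressureKernel_smul_right, Real.sq_sqrt (hc _)]

/-! ### The weight identity for the principal values -/

/-- **The commutator-free weight identity for the principal values.** Let `χ` be a weight,
`x₀` a centre, `c = χ(x₀) − χ`, `c₊ = max(c,0)`, `c₋ = max(−c,0)` (so `c = c₊ − c₋`,
`χ(x) = (χ(x) − χ(x₀)) + c₊(y) − c₋(y) + χ(y)` for every `y`). If at `x` the principal values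
`L = p.v.∫K(x−y)(w)`, `Lχ = p.v.∫K(x−y)(√χ w)`, `L₊ = p.v.∫K(x−y)(√c₊ w)`,
`L₋ = p.v.∫K(x−y)(√c₋ w)` exist, then `χ(x) L = (χ(x) − χ(x₀)) L + L₊ − L₋ + Lχ` (the truncated
integrals satisfy this identity for all small `ε`, by linearity of the integral, and one passes
to the limit). [cite: Seregin2014, App. B, proof of Lemma B.6, the splitting of q₁ (PDF pp. 154–155)] -/
theorem hasPressurePV_weight_identity
    {w : EuclideanSpace ℝ (Fin 3) → EuclideanSpace ℝ (Fin 3)} {χ : EuclideanSpace ℝ (Fin 3) → ℝ}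
    (hχ0 : ∀ y, 0 ≤ χ y) (x₀ : EuclideanSpace ℝ (Fin 3)) {x : EuclideanSpace ℝ (Fin 3)}
    {L Lχ Lp Lm : ℝ} (hL : HasPressurePV w x L)
    (hLχ : HasPressurePV (fun y => Real.sqrt (χ y) • w y) x Lχ)
    (hLp : HasPressurePV (fun y => Real.sqrt (max (χ x₀ - χ y) 0) • w y) x Lp)
    (hLm : HasPressurePV (fun y => Real.sqrt (max (χ y - χ x₀) 0) • w y) x Lm) :
    χ x * L = (χ x - χ x₀) * L + Lp - Lm + Lχ := by
  -- the combination of truncated integrals vanishes for all small `ε`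
  have hcp : ∀ y, 0 ≤ max (χ x₀ - χ y) 0 := fun y => le_max_right _ _
  have hcm : ∀ y, 0 ≤ max (χ y - χ x₀) 0 := fun y => le_max_right _ _
  have hev : ∀ᶠ ε in 𝓝[>] (0 : ℝ),
      χ x * truncatedPressureIntegral w x ε -
        ((χ x - χ x₀) * truncatedPressureIntegral w x ε +
          truncatedPressureIntegral (fun y => Real.sqrt (max (χ x₀ - χ y) 0) • w y) x ε -
          truncatedPressureIntegral (fun y => Real.sqrt (max (χ y - χ x₀) 0) • w y) x ε +
          truncatedPressureIntegral (fun y => Real.sqrt (χ y) • w y) x ε) = 0 := by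
    filter_upwards [hL.1, hLχ.1, hLp.1, hLm.1] with ε h1 h2 h3 h4
    set S : Set (EuclideanSpace ℝ (Fin 3)) := (closedBall x ε)ᶜ with hS
    have h2' : IntegrableOn (fun y => χ y * pressureKernel (x - y) (w y)) S volume := by
      simpa only [pressureKernel_sqrt_smul _ hχ0] using h2
    have h3' : IntegrableOn (fun y => max (χ x₀ - χ y) 0 * pressureKernel (x - y) (w y)) S volume := by
      simpa only [pressureKernel_sqrt_smul _ hcp] using h3
    have h4' : IntegrableOn (fun y => max (χ y - χ x₀) 0 * pressureKernel (x - y) (w y)) S volume := by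
      simpa only [pressureKernel_sqrt_smul _ hcm] using h4
    have h34 : IntegrableOn (fun y => max (χ x₀ - χ y) 0 * pressureKernel (x - y) (w y) -
        max (χ y - χ x₀) 0 * pressureKernel (x - y) (w y)) S volume := h3'.sub h4'
    have J1 : (∫ y in S, max (χ x₀ - χ y) 0 * pressureKernel (x - y) (w y)) -
        (∫ y in S, max (χ y - χ x₀) 0 * pressureKernel (x - y) (w y)) +
        (∫ y in S, χ y * pressureKernel (x - y) (w y)) =
        ∫ y in S, (max (χ x₀ - χ y) 0 * pressureKernel (x - y) (w y) -
          max (χ y - χ x₀) 0 * pressureKernel (x - y) (w y) + χ y * pressureKernel (x - y) (w y)) := by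
      rw [integral_add h34 h2', integral_sub h3' h4']
    have J2 : ∫ y in S, (max (χ x₀ - χ y) 0 * pressureKernel (x - y) (w y) -
          max (χ y - χ x₀) 0 * pressureKernel (x - y) (w y) + χ y * pressureKernel (x - y) (w y)) =
        χ x₀ * ∫ y in S, pressureKernel (x - y) (w y) := by
      rw [← integral_const_mul]
      refine integral_congr_ae (Eventually.of_forall fun y => ?_)
      have hmax : max (χ x₀ - χ y) 0 - max (χ y - χ x₀) 0 = χ x₀ - χ y := by
        rcases le_total (χ y) (χ x₀) with h | h
        · rw [max_eq_left (sub_nonneg.2 h), max_eq_right (sub_nonpos.2 h)]; ring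
        · rw [max_eq_right (sub_nonpos.2 h), max_eq_left (sub_nonneg.2 h)]; ring
      show max (χ x₀ - χ y) 0 * pressureKernel (x - y) (w y) -
          max (χ y - χ x₀) 0 * pressureKernel (x - y) (w y) + χ y * pressureKernel (x - y) (w y) =
        χ x₀ * pressureKernel (x - y) (w y)
      linear_combination pressureKernel (x - y) (w y) * hmax
    rw [truncatedPressureIntegral_sqrt_smul _ hχ0, truncatedPressureIntegral_sqrt_smul _ hcp,
      truncatedPressureIntegral_sqrt_smul _ hcm]
    simp only [truncatedPressureIntegral]
    linarith [J1, J2]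
  -- pass to the limit
  have hlim : Tendsto (fun ε => χ x * truncatedPressureIntegral w x ε -
      ((χ x - χ x₀) * truncatedPressureIntegral w x ε +
        truncatedPressureIntegral (fun y => Real.sqrt (max (χ x₀ - χ y) 0) • w y) x ε -
        truncatedPressureIntegral (fun y => Real.sqrt (max (χ y - χ x₀) 0) • w y) x ε +
        truncatedPressureIntegral (fun y => Real.sqrt (χ y) • w y) x ε)) (𝓝[>] 0)
      (𝓝 (χ x * L - ((χ x - χ x₀) * L + Lp - Lm + Lχ))) :=
    (hL.2.const_mul _).sub ((((hL.2.const_mul _).add hLp.2).sub hLm.2).add hLχ.2)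
  have h0 : χ x * L - ((χ x - χ x₀) * L + Lp - Lm + Lχ) = 0 :=
    tendsto_nhds_unique hlim (tendsto_const_nhds.congr' (hev.mono fun ε hε => hε.symm))
  linarith

/-- **The weight identity for the Riesz pressures** (Seregin's `χ_R p¹ = q₁ + q₂` with the
second splitting of `q₁`, PDF pp. 154–155, written without commutators): at a point where the
four principal values exist,
`χ(x) p̃[w](x) = p̃[√χ w](x) + (χ(x) − χ(x₀))(p̃[w](x) + |w(x)|²/3)
  + (p̃[√c₊ w](x) + c₊(x)|w(x)|²/3) − (p̃[√c₋ w](x) + c₋(x)|w(x)|²/3)`.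
[cite: Seregin2014, App. B, proof of Lemma B.6, (B.2.14)–(B.2.16), PDF pp. 154–155] -/
theorem normalisedPressure_weight_identity
    {w : EuclideanSpace ℝ (Fin 3) → EuclideanSpace ℝ (Fin 3)} {χ : EuclideanSpace ℝ (Fin 3) → ℝ}
    (hχ0 : ∀ y, 0 ≤ χ y) (x₀ : EuclideanSpace ℝ (Fin 3)) {x : EuclideanSpace ℝ (Fin 3)}
    (hL : ∃ L, HasPressurePV w x L)
    (hLχ : ∃ L, HasPressurePV (fun y => Real.sqrt (χ y) • w y) x L)
    (hLp : ∃ L, HasPressurePV (fun y => Real.sqrt (max (χ x₀ - χ y) 0) • w y) x L)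
    (hLm : ∃ L, HasPressurePV (fun y => Real.sqrt (max (χ y - χ x₀) 0) • w y) x L) :
    χ x * normalisedPressure w x =
      normalisedPressure (fun y => Real.sqrt (χ y) • w y) x +
        (χ x - χ x₀) * (normalisedPressure w x + ‖w x‖ ^ 2 / 3) +
        (normalisedPressure (fun y => Real.sqrt (max (χ x₀ - χ y) 0) • w y) x +
          max (χ x₀ - χ x) 0 * ‖w x‖ ^ 2 / 3) -
        (normalisedPressure (fun y => Real.sqrt (max (χ y - χ x₀) 0) • w y) x +
          max (χ x - χ x₀) 0 * ‖w x‖ ^ 2 / 3) := by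
  obtain ⟨L, hL⟩ := hL
  obtain ⟨Lχ, hLχ⟩ := hLχ
  obtain ⟨Lp, hLp⟩ := hLp
  obtain ⟨Lm, hLm⟩ := hLm
  have hid := hasPressurePV_weight_identity hχ0 x₀ hL hLχ hLp hLm
  have h3 : (Module.finrank ℝ (EuclideanSpace ℝ (Fin 3)) : ℝ) = 3 := by
    rw [finrank_euclideanSpace_fin]; norm_num
  rw [normalisedPressure_eq hL, normalisedPressure_eq hLχ, normalisedPressure_eq hLp,
    normalisedPressure_eq hLm, h3]
  have nχ : ‖Real.sqrt (χ x) • w x‖ ^ 2 = χ x * ‖w x‖ ^ 2 := by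
    rw [norm_smul, mul_pow, Real.norm_eq_abs, sq_abs, Real.sq_sqrt (hχ0 x)]
  have np : ‖Real.sqrt (max (χ x₀ - χ x) 0) • w x‖ ^ 2 = max (χ x₀ - χ x) 0 * ‖w x‖ ^ 2 := by
    rw [norm_smul, mul_pow, Real.norm_eq_abs, sq_abs, Real.sq_sqrt (le_max_right _ _)]
  have nm : ‖Real.sqrt (max (χ x - χ x₀) 0) • w x‖ ^ 2 = max (χ x - χ x₀) 0 * ‖w x‖ ^ 2 := by
    rw [norm_smul, mul_pow, Real.norm_eq_abs, sq_abs, Real.sq_sqrt (le_max_right _ _)]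
  simp only [nχ, np, nm]
  linear_combination hid


/-! ### Five-term power inequality -/

/-- `(a₁ + a₂ + a₃ + a₄ + a₅)^{3/2} ≤ 16 (a₁^{3/2} + ⋯ + a₅^{3/2})` in `ℝ≥0∞`. [folklore] -/
theorem add₅_rpow_threeHalves_le (a₁ a₂ a₃ a₄ a₅ : ℝ≥0∞) :
    (a₁ + a₂ + a₃ + a₄ + a₅) ^ (3 / 2 : ℝ) ≤
      16 * (a₁ ^ (3 / 2 : ℝ) + a₂ ^ (3 / 2 : ℝ) + a₃ ^ (3 / 2 : ℝ) + a₄ ^ (3 / 2 : ℝ) +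
        a₅ ^ (3 / 2 : ℝ)) := by
  have h2 : (2 : ℝ≥0∞) ^ (1 / 2 : ℝ) ≤ 2 := by
    have : (2 : ℝ≥0∞) ^ (1 / 2 : ℝ) ≤ (2 : ℝ≥0∞) ^ (1 : ℝ) :=
      ENNReal.rpow_le_rpow_of_exponent_le (by norm_num) (by norm_num)
    rwa [ENNReal.rpow_one] at this
  have step : ∀ a b : ℝ≥0∞, (a + b) ^ (3 / 2 : ℝ) ≤ 2 * (a ^ (3 / 2 : ℝ) + b ^ (3 / 2 : ℝ)) :=
    fun a b => (add_rpow_threeHalves_le a b).trans (mul_le_mul' h2 le_rfl)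
  calc (a₁ + a₂ + a₃ + a₄ + a₅) ^ (3 / 2 : ℝ)
      ≤ 2 * ((a₁ + a₂ + a₃ + a₄) ^ (3 / 2 : ℝ) + a₅ ^ (3 / 2 : ℝ)) := step _ _
    _ ≤ 2 * (2 * ((a₁ + a₂ + a₃) ^ (3 / 2 : ℝ) + a₄ ^ (3 / 2 : ℝ)) + a₅ ^ (3 / 2 : ℝ)) := by
        gcongr; exact step _ _
    _ ≤ 2 * (2 * (2 * ((a₁ + a₂) ^ (3 / 2 : ℝ) + a₃ ^ (3 / 2 : ℝ)) + a₄ ^ (3 / 2 : ℝ)) +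
          a₅ ^ (3 / 2 : ℝ)) := by
        gcongr; exact step _ _
    _ ≤ 2 * (2 * (2 * (2 * (a₁ ^ (3 / 2 : ℝ) + a₂ ^ (3 / 2 : ℝ)) + a₃ ^ (3 / 2 : ℝ)) +
          a₄ ^ (3 / 2 : ℝ)) + a₅ ^ (3 / 2 : ℝ)) := by
        gcongr; exact step _ _
    _ = 16 * a₁ ^ (3 / 2 : ℝ) + 16 * a₂ ^ (3 / 2 : ℝ) + 8 * a₃ ^ (3 / 2 : ℝ) +
          4 * a₄ ^ (3 / 2 : ℝ) + 2 * a₅ ^ (3 / 2 : ℝ) := by ring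
    _ ≤ 16 * a₁ ^ (3 / 2 : ℝ) + 16 * a₂ ^ (3 / 2 : ℝ) + 16 * a₃ ^ (3 / 2 : ℝ) +
          16 * a₄ ^ (3 / 2 : ℝ) + 16 * a₅ ^ (3 / 2 : ℝ) := by
        gcongr <;> norm_num
    _ = _ := by ring

/-! ### The `L^{3/2}` slice bound for `χ p_near` -/

/-- `‖(c : ℝ) * r‖ₑ ^ (3/2) = ofReal (c ^ (3/2)) * ‖r‖ₑ ^ (3/2)` for `c ≥ 0`. [folklore] -/
theorem enorm_const_mul_rpow_threeHalves {c : ℝ} (hc : 0 ≤ c) (r : ℝ) :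
    ‖c * r‖ₑ ^ (3 / 2 : ℝ) = ENNReal.ofReal (c ^ (3 / 2 : ℝ)) * ‖r‖ₑ ^ (3 / 2 : ℝ) := by
  rw [enorm_mul, ENNReal.mul_rpow_of_nonneg _ _ (by norm_num), Real.enorm_eq_ofReal hc,
    ENNReal.ofReal_rpow_of_nonneg hc (by norm_num)]

/-- **Seregin's (B.2.15)–(B.2.16) for the tree's near-field pressure.** There is an absolute
`C` such that for every continuous weight `χ` with `0 ≤ χ ≤ 1` and `|χ(x) − χ(y)| ≤ L|x − y|`,
every centre `x₀`, and every measurable slice `v(t)` with `∫_{B(x₀,4)}|v(t)|³ < ∞`,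
`∫_{B(x₀,3/2)} |χ p_near(t)|^{3/2} ≤ C (∫_{B(x₀,4)} χ^{3/2}|v(t)|³ + L^{3/2} ∫_{B(x₀,4)} |v(t)|³)`,
where `p_near = localPressureNear x₀ 2 v t = p̃[1_{B(x₀,4)} v(t)]` (the weight identity
`normalisedPressure_weight_identity` a.e., `|χ(x) − χ(x₀)|, c±(x) ≤ 3L/2` on `B(x₀,3/2)`,
`c± ≤ 4L` on `B(x₀,4)`, and the Calderón–Zygmund bound `‖p̃[w']‖_{3/2} ≤ C‖|w'|²‖_{3/2}` for the
four fields `w' = 1_B v, √χ 1_B v, √c₊ 1_B v, √c₋ 1_B v`). With `χ = χ_R`, `L = c/R` this is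
"`∫∫|q₂|^{3/2} ≤ c∫∫|χ_R|^{3/2}|v|³`" (B.2.15) and the bound for `q₁` leading to (B.2.16).
[cite: Seregin2014, App. B, proof of Lemma B.6, (B.2.14)–(B.2.16), PDF pp. 154–155] -/
theorem exists_lintegral_cutoff_mul_localPressureNear_rpow_le :
    ∃ C : ℝ≥0, ∀ (χ : EuclideanSpace ℝ (Fin 3) → ℝ) (L : ℝ), Continuous χ → (∀ y, 0 ≤ χ y ∧ χ y ≤ 1) → 0 ≤ L →
      (∀ x y, |χ x - χ y| ≤ L * ‖x - y‖) →
      ∀ (x₀ : EuclideanSpace ℝ (Fin 3)) (v : ℝ → EuclideanSpace ℝ (Fin 3) → EuclideanSpace ℝ (Fin 3)) (t : ℝ), AEStronglyMeasurable (v t) volume →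
        ∫⁻ x in ball x₀ 4, ‖v t x‖ₑ ^ (3 : ℕ) ≠ ⊤ →
        ∫⁻ x in ball x₀ (3 / 2), ‖χ x * localPressureNear x₀ 2 v t x‖ₑ ^ (3 / 2 : ℝ) ≤
          C * ((∫⁻ x in ball x₀ 4, ENNReal.ofReal (χ x ^ (3 / 2 : ℝ)) * ‖v t x‖ₑ ^ (3 : ℕ)) +
            ENNReal.ofReal (L ^ (3 / 2 : ℝ)) * ∫⁻ x in ball x₀ 4, ‖v t x‖ₑ ^ (3 : ℕ)) := by
  -- the Calderón–Zygmund constant at `p = 3/2`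
  obtain ⟨Ccz, hCcz⟩ := stein1970_normalisedPressure_ae_Lp_bound_holds (3 / 2)
    ((ENNReal.lt_div_iff_mul_lt (Or.inl two_ne_zero) (Or.inl ENNReal.ofNat_ne_top)).2
      (by norm_num))
    (lt_top_iff_ne_top.2 (ENNReal.div_ne_top (by norm_num) (by norm_num)))
  set K : ℝ≥0∞ := ((max Ccz 1 : ℝ≥0) : ℝ≥0∞) ^ (3 / 2 : ℝ) with hK
  have hKtop : K ≠ ⊤ := ENNReal.rpow_ne_top_of_nonneg (by norm_num) ENNReal.coe_ne_top
  -- numerical constants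
  set A32 : ℝ≥0∞ := ENNReal.ofReal ((3 / 2 : ℝ) ^ (3 / 2 : ℝ)) with hA32
  set B32 : ℝ≥0∞ := ENNReal.ofReal ((4 : ℝ) ^ (3 / 2 : ℝ)) with hB32
  set Ctot : ℝ≥0∞ := 16 * (K + A32 * K + B32 * K + B32 * K + A32) * 2 with hCtot
  have hCtot_top : Ctot ≠ ⊤ := by
    have hA : A32 ≠ ⊤ := ENNReal.ofReal_ne_top
    have hB : B32 ≠ ⊤ := ENNReal.ofReal_ne_top
    exact ENNReal.mul_ne_top (ENNReal.mul_ne_top (by norm_num) (ENNReal.add_ne_top.2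
      ⟨ENNReal.add_ne_top.2 ⟨ENNReal.add_ne_top.2 ⟨ENNReal.add_ne_top.2 ⟨hKtop,
      ENNReal.mul_ne_top hA hKtop⟩, ENNReal.mul_ne_top hB hKtop⟩, ENNReal.mul_ne_top hB hKtop⟩, hA⟩))
      (by norm_num)
  refine ⟨Ctot.toNNReal, ?_⟩
  intro χ L hχc hχ01 hL0 hLip x₀ v t hvm hfin
  rw [ENNReal.coe_toNNReal hCtot_top]
  -- the cut-off slice and the three weighted fields
  set S : Set (EuclideanSpace ℝ (Fin 3)) := ball x₀ 4 with hS
  set w : EuclideanSpace ℝ (Fin 3) → EuclideanSpace ℝ (Fin 3) := S.indicator (v t) with hw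
  have hwm : AEStronglyMeasurable w volume := hvm.indicator measurableSet_ball
  set cp : EuclideanSpace ℝ (Fin 3) → ℝ := fun y => max (χ x₀ - χ y) 0 with hcp
  set cm : EuclideanSpace ℝ (Fin 3) → ℝ := fun y => max (χ y - χ x₀) 0 with hcm
  have hcp0 : ∀ y, 0 ≤ cp y := fun y => le_max_right _ _
  have hcm0 : ∀ y, 0 ≤ cm y := fun y => le_max_right _ _
  have hcpc : Continuous cp := (continuous_const.sub hχc).max continuous_const
  have hcmc : Continuous cm := (hχc.sub continuous_const).max continuous_const
  -- `|c(y)| ≤ 4L` on `S`, `≤ 3L/2` on `B(x₀,3/2)`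
  have hc_le : ∀ {y : EuclideanSpace ℝ (Fin 3)} {r : ℝ}, ‖y - x₀‖ < r → cp y ≤ L * r ∧ cm y ≤ L * r := by
    intro y r hy
    have h := hLip x₀ y
    have h' : L * ‖x₀ - y‖ ≤ L * r := by
      rw [norm_sub_rev]; exact mul_le_mul_of_nonneg_left hy.le hL0
    have hab := abs_sub_le_iff.1 (h.trans h')
    have hr : 0 ≤ L * r := mul_nonneg hL0 ((norm_nonneg _).trans hy.le)
    exact ⟨max_le hab.1 hr, max_le (by linarith [hab.2]) hr⟩
  set wχ : EuclideanSpace ℝ (Fin 3) → EuclideanSpace ℝ (Fin 3) := fun y => Real.sqrt (χ y) • w y with hwχ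
  set wp : EuclideanSpace ℝ (Fin 3) → EuclideanSpace ℝ (Fin 3) := fun y => Real.sqrt (cp y) • w y with hwp
  set wm : EuclideanSpace ℝ (Fin 3) → EuclideanSpace ℝ (Fin 3) := fun y => Real.sqrt (cm y) • w y with hwm'
  have hwχm : AEStronglyMeasurable wχ volume :=
    (Real.continuous_sqrt.comp hχc).aestronglyMeasurable.smul hwm
  have hwpm : AEStronglyMeasurable wp volume :=
    (Real.continuous_sqrt.comp hcpc).aestronglyMeasurable.smul hwm
  have hwmm : AEStronglyMeasurable wm volume :=
    (Real.continuous_sqrt.comp hcmc).aestronglyMeasurable.smul hwm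
  -- `‖ |w|² ‖ₑ^{3/2}` is the cut-off `|v(t)|³`
  have hpt : ∀ x, ‖(‖w x‖ ^ 2 : ℝ)‖ₑ ^ (3 / 2 : ℝ) = S.indicator (fun x => ‖v t x‖ₑ ^ (3 : ℕ)) x := by
    intro x
    rw [enorm_norm_sq_rpow_threeHalves, hw, enorm_indicator_eq_indicator_enorm]
    by_cases hx : x ∈ S
    · rw [indicator_of_mem hx, indicator_of_mem hx]
    · rw [indicator_of_notMem hx, indicator_of_notMem hx, zero_pow three_ne_zero]
  have hlin : ∫⁻ x, ‖(‖w x‖ ^ 2 : ℝ)‖ₑ ^ (3 / 2 : ℝ) = ∫⁻ x in S, ‖v t x‖ₑ ^ (3 : ℕ) := by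
    rw [← lintegral_indicator measurableSet_ball]
    exact lintegral_congr hpt
  have hfinS : ∫⁻ x in S, ‖v t x‖ₑ ^ (3 : ℕ) ≠ ⊤ := hfin
  have hnear : ∀ x, localPressureNear x₀ 2 v t x = normalisedPressure w x := fun x => by
    rw [localPressureNear_apply, hw, hS]
    norm_num
  have hsq_meas : AEStronglyMeasurable (fun x => ‖w x‖ ^ 2) volume :=
    (continuous_norm.pow 2).comp_aestronglyMeasurable hwm
  have hmem : MemLp (fun x => ‖w x‖ ^ 2) (3 / 2 : ℝ≥0∞) volume := by
    refine ⟨hsq_meas, eLpNorm_threeHalves_lt_top_of_lintegral ?_⟩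
    rw [hlin]
    exact hfinS
  -- squared norms of the weighted fields
  have nsq : ∀ {c : EuclideanSpace ℝ (Fin 3) → ℝ} (hc : ∀ y, 0 ≤ c y) (y : EuclideanSpace ℝ (Fin 3)),
      ‖Real.sqrt (c y) • w y‖ ^ 2 = c y * ‖w y‖ ^ 2 := by
    intro c hc y
    rw [norm_smul, mul_pow, Real.norm_eq_abs, sq_abs, Real.sq_sqrt (hc y)]
  have hχ0 : ∀ y, 0 ≤ χ y := fun y => (hχ01 y).1
  -- weights are `≤ 1`, so the weighted squares are dominated by `|w|²`
  have hcp1 : ∀ y, cp y ≤ 1 := fun y =>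
    max_le (by linarith [(hχ01 x₀).2, (hχ01 y).1]) zero_le_one
  have hcm1 : ∀ y, cm y ≤ 1 := fun y =>
    max_le (by linarith [(hχ01 y).2, (hχ01 x₀).1]) zero_le_one
  have hmem_of : ∀ {c : EuclideanSpace ℝ (Fin 3) → ℝ} (hc : ∀ y, 0 ≤ c y) (hc1 : ∀ y, c y ≤ 1) (hcc : Continuous c),
      MemLp (fun x => ‖Real.sqrt (c x) • w x‖ ^ 2) (3 / 2 : ℝ≥0∞) volume := by
    intro c hc hc1 hcc
    refine hmem.of_le ((continuous_norm.pow 2).comp_aestronglyMeasurable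
      ((Real.continuous_sqrt.comp hcc).aestronglyMeasurable.smul hwm)) (Eventually.of_forall
      fun y => ?_)
    rw [nsq hc, Real.norm_eq_abs, Real.norm_eq_abs, abs_of_nonneg (mul_nonneg (hc y) (sq_nonneg _)),
      abs_of_nonneg (sq_nonneg _)]
    exact mul_le_of_le_one_left (sq_nonneg _) (hc1 y)
  have hmemχ := hmem_of hχ0 (fun y => (hχ01 y).2) hχc
  have hmemp := hmem_of hcp0 hcp1 hcpc
  have hmemm := hmem_of hcm0 hcm1 hcmc
  -- the four CZ statements
  obtain ⟨hae0, hb0⟩ := hCcz w hwm hmem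
  obtain ⟨haeχ, hbχ⟩ := hCcz wχ hwχm hmemχ
  obtain ⟨haep, hbp⟩ := hCcz wp hwpm hmemp
  obtain ⟨haem, hbm⟩ := hCcz wm hwmm hmemm
  -- CZ in the `∫ ‖·‖ₑ^{3/2}` form: `∫ |p̃[√c w]|^{3/2} ≤ K ∫ c^{3/2} |w|³`
  have hK1 : ((Ccz : ℝ≥0∞)) ^ (3 / 2 : ℝ) ≤ K := by
    rw [hK]; gcongr; exact_mod_cast le_max_left _ _
  have hCZ : ∀ {u : EuclideanSpace ℝ (Fin 3) → EuclideanSpace ℝ (Fin 3)}, eLpNorm (normalisedPressure u) (3 / 2 : ℝ≥0∞) volume ≤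
      Ccz * eLpNorm (fun x => ‖u x‖ ^ 2) (3 / 2 : ℝ≥0∞) volume →
      ∫⁻ x, ‖normalisedPressure u x‖ₑ ^ (3 / 2 : ℝ) ≤ K * ∫⁻ x, ‖(‖u x‖ ^ 2 : ℝ)‖ₑ ^ (3 / 2 : ℝ) := by
    intro u hb
    rw [lintegral_rpow_threeHalves_eq, lintegral_rpow_threeHalves_eq]
    calc eLpNorm (normalisedPressure u) (3 / 2 : ℝ≥0∞) volume ^ (3 / 2 : ℝ)
        ≤ ((Ccz : ℝ≥0∞) * eLpNorm (fun x => ‖u x‖ ^ 2) (3 / 2 : ℝ≥0∞) volume) ^ (3 / 2 : ℝ) :=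
          ENNReal.rpow_le_rpow hb (by norm_num)
      _ = (Ccz : ℝ≥0∞) ^ (3 / 2 : ℝ) * eLpNorm (fun x => ‖u x‖ ^ 2) (3 / 2 : ℝ≥0∞) volume ^ (3 / 2 : ℝ) :=
          ENNReal.mul_rpow_of_nonneg _ _ (by norm_num)
      _ ≤ K * eLpNorm (fun x => ‖u x‖ ^ 2) (3 / 2 : ℝ≥0∞) volume ^ (3 / 2 : ℝ) :=
          mul_le_mul' hK1 le_rfl
  -- `∫ ‖ c |w|² ‖ₑ^{3/2} ≤ M^{3/2} ∫_S |v|³` when `0 ≤ c ≤ M` on `S`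
  have hweight : ∀ {c : EuclideanSpace ℝ (Fin 3) → ℝ} (hc : ∀ y, 0 ≤ c y) {M : ℝ} (hM : ∀ y ∈ S, c y ≤ M),
      ∫⁻ x, ‖(‖Real.sqrt (c x) • w x‖ ^ 2 : ℝ)‖ₑ ^ (3 / 2 : ℝ) ≤
        ENNReal.ofReal (M ^ (3 / 2 : ℝ)) * ∫⁻ x in S, ‖v t x‖ₑ ^ (3 : ℕ) := by
    intro c hc M hM
    rw [← hlin, ← lintegral_const_mul' _ _ ENNReal.ofReal_ne_top]
    refine lintegral_mono fun y => ?_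
    rw [nsq hc, enorm_const_mul_rpow_threeHalves (hc y)]
    by_cases hy : y ∈ S
    · refine mul_le_mul' (ENNReal.ofReal_le_ofReal ?_) le_rfl
      exact Real.rpow_le_rpow (hc y) (hM y hy) (by norm_num)
    · have : w y = 0 := by rw [hw, indicator_of_notMem hy]
      simp [this]
  have hweight_exact : ∫⁻ x, ‖(‖wχ x‖ ^ 2 : ℝ)‖ₑ ^ (3 / 2 : ℝ) =
      ∫⁻ x in S, ENNReal.ofReal (χ x ^ (3 / 2 : ℝ)) * ‖v t x‖ₑ ^ (3 : ℕ) := by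
    rw [← lintegral_indicator measurableSet_ball]
    refine lintegral_congr fun y => ?_
    show ‖(‖Real.sqrt (χ y) • w y‖ ^ 2 : ℝ)‖ₑ ^ (3 / 2 : ℝ) = _
    rw [nsq hχ0, enorm_const_mul_rpow_threeHalves (hχ0 y), hpt y]
    by_cases hy : y ∈ S
    · rw [indicator_of_mem hy, indicator_of_mem hy]
    · rw [indicator_of_notMem hy, indicator_of_notMem hy, mul_zero]
  -- the a.e. pointwise bound on `B(x₀, 3/2)`
  have hMx : ∀ {x : EuclideanSpace ℝ (Fin 3)}, x ∈ ball x₀ (3 / 2) → |χ x - χ x₀| ≤ 3 / 2 * L ∧ cp x ≤ 3 / 2 * L ∧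
      cm x ≤ 3 / 2 * L := by
    intro x hx
    rw [mem_ball, dist_eq_norm] at hx
    have h := hc_le hx
    refine ⟨?_, by linarith [h.1], by linarith [h.2]⟩
    calc |χ x - χ x₀| ≤ L * ‖x - x₀‖ := hLip x x₀
      _ ≤ L * (3 / 2) := mul_le_mul_of_nonneg_left hx.le hL0
      _ = 3 / 2 * L := by ring
  have hae : ∀ᵐ x : EuclideanSpace ℝ (Fin 3), x ∈ ball x₀ (3 / 2) →
      ‖χ x * normalisedPressure w x‖ₑ ^ (3 / 2 : ℝ) ≤
        16 * (‖normalisedPressure wχ x‖ₑ ^ (3 / 2 : ℝ) +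
          (ENNReal.ofReal (3 / 2 * L) * ‖normalisedPressure w x‖ₑ) ^ (3 / 2 : ℝ) +
          ‖normalisedPressure wp x‖ₑ ^ (3 / 2 : ℝ) + ‖normalisedPressure wm x‖ₑ ^ (3 / 2 : ℝ) +
          (ENNReal.ofReal (3 / 2 * L) * ‖(‖w x‖ ^ 2 : ℝ)‖ₑ) ^ (3 / 2 : ℝ)) := by
    filter_upwards [hae0, haeχ, haep, haem] with x h0 hχ' hp hm hx
    have hid := normalisedPressure_weight_identity hχ0 x₀ h0 hχ' hp hm
    obtain ⟨h1, h2, h3⟩ := hMx hx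
    -- real-valued absolute bound
    have hreal : |χ x * normalisedPressure w x| ≤
        |normalisedPressure wχ x| + 3 / 2 * L * |normalisedPressure w x| +
          |normalisedPressure wp x| + |normalisedPressure wm x| + 3 / 2 * L * ‖w x‖ ^ 2 := by
      rw [hid]
      have hw2 : 0 ≤ ‖w x‖ ^ 2 := sq_nonneg _
      have e1 : |(χ x - χ x₀) * (normalisedPressure w x + ‖w x‖ ^ 2 / 3)| ≤
          3 / 2 * L * |normalisedPressure w x| + 3 / 2 * L * (‖w x‖ ^ 2 / 3) := by
        rw [abs_mul]
        calc |χ x - χ x₀| * |normalisedPressure w x + ‖w x‖ ^ 2 / 3|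
            ≤ (3 / 2 * L) * (|normalisedPressure w x| + ‖w x‖ ^ 2 / 3) := by
              refine mul_le_mul h1 ((abs_add_le _ _).trans ?_) (abs_nonneg _) (by positivity)
              rw [abs_of_nonneg (by positivity : (0 : ℝ) ≤ ‖w x‖ ^ 2 / 3)]
          _ = _ := by ring
      have e2 : |normalisedPressure wp x + cp x * ‖w x‖ ^ 2 / 3| ≤
          |normalisedPressure wp x| + 3 / 2 * L * (‖w x‖ ^ 2 / 3) := by
        refine (abs_add_le _ _).trans (add_le_add le_rfl ?_)
        rw [abs_of_nonneg (by positivity : 0 ≤ cp x * ‖w x‖ ^ 2 / 3)]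
        have := mul_le_mul_of_nonneg_right h2 hw2
        linarith
      have e3 : |normalisedPressure wm x + cm x * ‖w x‖ ^ 2 / 3| ≤
          |normalisedPressure wm x| + 3 / 2 * L * (‖w x‖ ^ 2 / 3) := by
        refine (abs_add_le _ _).trans (add_le_add le_rfl ?_)
        rw [abs_of_nonneg (by positivity : 0 ≤ cm x * ‖w x‖ ^ 2 / 3)]
        have := mul_le_mul_of_nonneg_right h3 hw2
        linarith
      calc |normalisedPressure wχ x + (χ x - χ x₀) * (normalisedPressure w x + ‖w x‖ ^ 2 / 3) +
            (normalisedPressure wp x + cp x * ‖w x‖ ^ 2 / 3) -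
            (normalisedPressure wm x + cm x * ‖w x‖ ^ 2 / 3)|
          ≤ |normalisedPressure wχ x| + |(χ x - χ x₀) * (normalisedPressure w x + ‖w x‖ ^ 2 / 3)| +
            |normalisedPressure wp x + cp x * ‖w x‖ ^ 2 / 3| +
            |normalisedPressure wm x + cm x * ‖w x‖ ^ 2 / 3| :=
            (abs_sub _ _).trans (add_le_add ((abs_add_le _ _).trans
              (add_le_add (abs_add_le _ _) le_rfl)) le_rfl)
        _ ≤ _ := by linarith [e1, e2, e3]
    -- to `ℝ≥0∞`
    have hsum : ‖χ x * normalisedPressure w x‖ₑ ≤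
        ‖normalisedPressure wχ x‖ₑ + ENNReal.ofReal (3 / 2 * L) * ‖normalisedPressure w x‖ₑ +
          ‖normalisedPressure wp x‖ₑ + ‖normalisedPressure wm x‖ₑ +
          ENNReal.ofReal (3 / 2 * L) * ‖(‖w x‖ ^ 2 : ℝ)‖ₑ := by
      rw [Real.enorm_eq_ofReal_abs, Real.enorm_eq_ofReal_abs, Real.enorm_eq_ofReal_abs,
        Real.enorm_eq_ofReal_abs, Real.enorm_eq_ofReal_abs, Real.enorm_eq_ofReal_abs,
        abs_of_nonneg (sq_nonneg ‖w x‖), ← ENNReal.ofReal_mul (by positivity),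
        ← ENNReal.ofReal_mul (by positivity), ← ENNReal.ofReal_add (by positivity) (by positivity),
        ← ENNReal.ofReal_add (by positivity) (by positivity),
        ← ENNReal.ofReal_add (by positivity) (by positivity),
        ← ENNReal.ofReal_add (by positivity) (by positivity)]
      exact ENNReal.ofReal_le_ofReal hreal
    exact (ENNReal.rpow_le_rpow hsum (by norm_num)).trans (add₅_rpow_threeHalves_le _ _ _ _ _)
  -- integrate over `B(x₀, 3/2)`
  have hL32 : 0 ≤ (3 / 2 * L) := by positivity
  have e_rpow : ∀ z : ℝ≥0∞, (ENNReal.ofReal (3 / 2 * L) * z) ^ (3 / 2 : ℝ) =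
      A32 * ENNReal.ofReal (L ^ (3 / 2 : ℝ)) * z ^ (3 / 2 : ℝ) := by
    intro z
    rw [ENNReal.mul_rpow_of_nonneg _ _ (by norm_num), ENNReal.ofReal_rpow_of_nonneg hL32 (by norm_num),
      Real.mul_rpow (by norm_num) hL0, ENNReal.ofReal_mul (Real.rpow_nonneg (by norm_num) _), hA32]
  -- measurability of the five integrands
  have hmeas_np : ∀ {u : EuclideanSpace ℝ (Fin 3) → EuclideanSpace ℝ (Fin 3)}, AEStronglyMeasurable u volume →
      MemLp (fun x => ‖u x‖ ^ 2) (3 / 2 : ℝ≥0∞) volume → (∀ y, ‖u y‖ ≤ ‖w y‖) →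
      AEMeasurable (fun x => ‖normalisedPressure u x‖ₑ ^ (3 / 2 : ℝ)) volume := by
    intro u hum humem hule
    refine (aestronglyMeasurable_normalisedPressure_of_sq_integrable hum ?_).enorm.pow_const _
    -- `|u|² ≤ |w|² = 1_S |v t|²` is integrable: `S` has finite measure and `|v t|³ ∈ L¹(S)`
    have hS_fin : volume S < ⊤ := measure_ball_lt_top
    haveI : IsFiniteMeasure (volume.restrict S) := isFiniteMeasure_restrict.2 hS_fin.ne
    have hv3 : MemLp (v t) 3 (volume.restrict S) := by
      refine ⟨hvm.restrict, ?_⟩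
      rw [eLpNorm_eq_lintegral_rpow_enorm_toReal (by norm_num) (by norm_num)]
      refine ENNReal.rpow_lt_top_of_nonneg (by norm_num) ?_
      rw [ENNReal.toReal_ofNat]
      have : ∫⁻ x in S, ‖v t x‖ₑ ^ (3 : ℝ) = ∫⁻ x in S, ‖v t x‖ₑ ^ (3 : ℕ) :=
        lintegral_congr fun x => by rw [show (3 : ℝ) = ((3 : ℕ) : ℝ) by norm_num, ENNReal.rpow_natCast]
      rw [this]
      exact hfinS
    have hv2 : MemLp (v t) 2 (volume.restrict S) := hv3.mono_exponent (by norm_num)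
    have hint2 : IntegrableOn (fun x => ‖v t x‖ ^ 2) S volume :=
      (memLp_two_iff_integrable_sq_norm hvm.restrict).1 hv2
    have hw2 : Integrable (fun x => ‖w x‖ ^ 2) volume := by
      have h := hint2.integrable_indicator measurableSet_ball
      refine h.congr (Eventually.of_forall fun y => ?_)
      show S.indicator (fun x => ‖v t x‖ ^ 2) y = ‖w y‖ ^ 2
      rw [hw]
      by_cases hy : y ∈ S
      · rw [indicator_of_mem hy, indicator_of_mem hy]
      · rw [indicator_of_notMem hy, indicator_of_notMem hy, norm_zero]; ring
    refine hw2.mono ((continuous_norm.pow 2).comp_aestronglyMeasurable hum)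
      (Eventually.of_forall fun y => ?_)
    rw [Real.norm_eq_abs, Real.norm_eq_abs, abs_of_nonneg (sq_nonneg ‖u y‖),
      abs_of_nonneg (sq_nonneg ‖w y‖)]
    exact pow_le_pow_left₀ (norm_nonneg _) (hule y) 2
  have hle_w : ∀ {c : EuclideanSpace ℝ (Fin 3) → ℝ} (hc : ∀ y, 0 ≤ c y) (hc1 : ∀ y, c y ≤ 1) (y : EuclideanSpace ℝ (Fin 3)),
      ‖Real.sqrt (c y) • w y‖ ≤ ‖w y‖ := by
    intro c hc hc1 y
    rw [norm_smul, Real.norm_eq_abs, abs_of_nonneg (Real.sqrt_nonneg _)]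
    exact mul_le_of_le_one_left (norm_nonneg _) ((Real.sqrt_le_one).2 (hc1 y))
  have m0 := hmeas_np hwm hmem (fun y => le_rfl)
  have mχ := hmeas_np hwχm hmemχ (hle_w hχ0 (fun y => (hχ01 y).2))
  have mp := hmeas_np hwpm hmemp (hle_w hcp0 hcp1)
  have mm := hmeas_np hwmm hmemm (hle_w hcm0 hcm1)
  have msq : AEMeasurable (fun x => ‖(‖w x‖ ^ 2 : ℝ)‖ₑ ^ (3 / 2 : ℝ)) volume :=
    hsq_meas.enorm.pow_const _
  -- the five integrals
  set I₁ := ∫⁻ x, ‖normalisedPressure wχ x‖ₑ ^ (3 / 2 : ℝ) with hI₁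
  set I₂ := ∫⁻ x, ‖normalisedPressure w x‖ₑ ^ (3 / 2 : ℝ) with hI₂
  set I₃ := ∫⁻ x, ‖normalisedPressure wp x‖ₑ ^ (3 / 2 : ℝ) with hI₃
  set I₄ := ∫⁻ x, ‖normalisedPressure wm x‖ₑ ^ (3 / 2 : ℝ) with hI₄
  set I₅ := ∫⁻ x, ‖(‖w x‖ ^ 2 : ℝ)‖ₑ ^ (3 / 2 : ℝ) with hI₅
  set X := ∫⁻ x in S, ENNReal.ofReal (χ x ^ (3 / 2 : ℝ)) * ‖v t x‖ₑ ^ (3 : ℕ) with hX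
  set Y := ∫⁻ x in S, ‖v t x‖ₑ ^ (3 : ℕ) with hY
  have bI₁ : I₁ ≤ K * X := by rw [← hweight_exact]; exact hCZ hbχ
  have bI₂ : I₂ ≤ K * Y := by rw [← hlin]; exact hCZ hb0
  have bI₃ : I₃ ≤ K * (B32 * ENNReal.ofReal (L ^ (3 / 2 : ℝ)) * Y) := by
    refine (hCZ hbp).trans (mul_le_mul' le_rfl ?_)
    have h := hweight hcp0 (M := L * 4) (fun y hy => (hc_le (by
      rw [hS, mem_ball, dist_eq_norm] at hy; exact hy)).1)
    refine h.trans (le_of_eq ?_)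
    rw [Real.mul_rpow hL0 (by norm_num), ENNReal.ofReal_mul (Real.rpow_nonneg hL0 _), hB32]
    ring
  have bI₄ : I₄ ≤ K * (B32 * ENNReal.ofReal (L ^ (3 / 2 : ℝ)) * Y) := by
    refine (hCZ hbm).trans (mul_le_mul' le_rfl ?_)
    have h := hweight hcm0 (M := L * 4) (fun y hy => (hc_le (by
      rw [hS, mem_ball, dist_eq_norm] at hy; exact hy)).2)
    refine h.trans (le_of_eq ?_)
    rw [Real.mul_rpow hL0 (by norm_num), ENNReal.ofReal_mul (Real.rpow_nonneg hL0 _), hB32]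
    ring
  have bI₅ : I₅ = Y := hlin
  -- integrate the a.e. bound
  calc ∫⁻ x in ball x₀ (3 / 2), ‖χ x * localPressureNear x₀ 2 v t x‖ₑ ^ (3 / 2 : ℝ)
      = ∫⁻ x in ball x₀ (3 / 2), ‖χ x * normalisedPressure w x‖ₑ ^ (3 / 2 : ℝ) := by
        simp only [hnear]
    _ ≤ ∫⁻ x in ball x₀ (3 / 2), 16 * (‖normalisedPressure wχ x‖ₑ ^ (3 / 2 : ℝ) +
          (ENNReal.ofReal (3 / 2 * L) * ‖normalisedPressure w x‖ₑ) ^ (3 / 2 : ℝ) +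
          ‖normalisedPressure wp x‖ₑ ^ (3 / 2 : ℝ) + ‖normalisedPressure wm x‖ₑ ^ (3 / 2 : ℝ) +
          (ENNReal.ofReal (3 / 2 * L) * ‖(‖w x‖ ^ 2 : ℝ)‖ₑ) ^ (3 / 2 : ℝ)) :=
        setLIntegral_mono_ae' measurableSet_ball hae
    _ ≤ ∫⁻ x, 16 * (‖normalisedPressure wχ x‖ₑ ^ (3 / 2 : ℝ) +
          (ENNReal.ofReal (3 / 2 * L) * ‖normalisedPressure w x‖ₑ) ^ (3 / 2 : ℝ) +
          ‖normalisedPressure wp x‖ₑ ^ (3 / 2 : ℝ) + ‖normalisedPressure wm x‖ₑ ^ (3 / 2 : ℝ) +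
          (ENNReal.ofReal (3 / 2 * L) * ‖(‖w x‖ ^ 2 : ℝ)‖ₑ) ^ (3 / 2 : ℝ)) :=
        setLIntegral_le_lintegral _ _
    _ = 16 * (I₁ + A32 * ENNReal.ofReal (L ^ (3 / 2 : ℝ)) * I₂ + I₃ + I₄ +
          A32 * ENNReal.ofReal (L ^ (3 / 2 : ℝ)) * I₅) := by
        simp only [e_rpow]
        have m2 : AEMeasurable (fun x => A32 * ENNReal.ofReal (L ^ (3 / 2 : ℝ)) *
            ‖normalisedPressure w x‖ₑ ^ (3 / 2 : ℝ)) volume := m0.const_mul _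
        have m5 : AEMeasurable (fun x => A32 * ENNReal.ofReal (L ^ (3 / 2 : ℝ)) *
            ‖(‖w x‖ ^ 2 : ℝ)‖ₑ ^ (3 / 2 : ℝ)) volume := msq.const_mul _
        have m12 : AEMeasurable (fun x => ‖normalisedPressure wχ x‖ₑ ^ (3 / 2 : ℝ) +
            A32 * ENNReal.ofReal (L ^ (3 / 2 : ℝ)) * ‖normalisedPressure w x‖ₑ ^ (3 / 2 : ℝ)) volume :=
          mχ.add m2
        have m123 : AEMeasurable (fun x => ‖normalisedPressure wχ x‖ₑ ^ (3 / 2 : ℝ) +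
            A32 * ENNReal.ofReal (L ^ (3 / 2 : ℝ)) * ‖normalisedPressure w x‖ₑ ^ (3 / 2 : ℝ) +
            ‖normalisedPressure wp x‖ₑ ^ (3 / 2 : ℝ)) volume := m12.add mp
        have m1234 : AEMeasurable (fun x => ‖normalisedPressure wχ x‖ₑ ^ (3 / 2 : ℝ) +
            A32 * ENNReal.ofReal (L ^ (3 / 2 : ℝ)) * ‖normalisedPressure w x‖ₑ ^ (3 / 2 : ℝ) +
            ‖normalisedPressure wp x‖ₑ ^ (3 / 2 : ℝ) + ‖normalisedPressure wm x‖ₑ ^ (3 / 2 : ℝ)) volume :=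
          m123.add mm
        have hA32top : A32 * ENNReal.ofReal (L ^ (3 / 2 : ℝ)) ≠ ⊤ :=
          ENNReal.mul_ne_top ENNReal.ofReal_ne_top ENNReal.ofReal_ne_top
        rw [lintegral_const_mul' _ _ (by norm_num), lintegral_add_left' m1234,
          lintegral_add_left' m123, lintegral_add_left' m12, lintegral_add_left' mχ,
          lintegral_const_mul' _ _ hA32top, lintegral_const_mul' _ _ hA32top]
    _ ≤ 16 * (K * X + A32 * ENNReal.ofReal (L ^ (3 / 2 : ℝ)) * (K * Y) +
          K * (B32 * ENNReal.ofReal (L ^ (3 / 2 : ℝ)) * Y) +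
          K * (B32 * ENNReal.ofReal (L ^ (3 / 2 : ℝ)) * Y) +
          A32 * ENNReal.ofReal (L ^ (3 / 2 : ℝ)) * Y) := by
        exact mul_le_mul' le_rfl (add_le_add (add_le_add (add_le_add (add_le_add bI₁
          (mul_le_mul' le_rfl bI₂)) bI₃) bI₄) (le_of_eq (by rw [bI₅])))
    _ ≤ Ctot * (X + ENNReal.ofReal (L ^ (3 / 2 : ℝ)) * Y) := by
        rw [hCtot]
        have eq : 16 * (K * X + A32 * ENNReal.ofReal (L ^ (3 / 2 : ℝ)) * (K * Y) +
            K * (B32 * ENNReal.ofReal (L ^ (3 / 2 : ℝ)) * Y) +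
            K * (B32 * ENNReal.ofReal (L ^ (3 / 2 : ℝ)) * Y) +
            A32 * ENNReal.ofReal (L ^ (3 / 2 : ℝ)) * Y) =
            16 * (K * X + (A32 * K + B32 * K + B32 * K + A32) * (ENNReal.ofReal (L ^ (3 / 2 : ℝ)) * Y)) := by
          ring
        rw [eq]
        have i1 : K * X ≤ (K + A32 * K + B32 * K + B32 * K + A32) * (X + ENNReal.ofReal (L ^ (3 / 2 : ℝ)) * Y) :=
          mul_le_mul' (le_add_right (le_add_right (le_add_right (le_add_right le_rfl))))
            (le_add_right le_rfl)
        have i2 : (A32 * K + B32 * K + B32 * K + A32) * (ENNReal.ofReal (L ^ (3 / 2 : ℝ)) * Y) ≤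
            (K + A32 * K + B32 * K + B32 * K + A32) * (X + ENNReal.ofReal (L ^ (3 / 2 : ℝ)) * Y) := by
          refine mul_le_mul' ?_ le_add_self
          calc A32 * K + B32 * K + B32 * K + A32 ≤ K + (A32 * K + B32 * K + B32 * K + A32) := le_add_self
            _ = K + A32 * K + B32 * K + B32 * K + A32 := by ring
        calc 16 * (K * X + (A32 * K + B32 * K + B32 * K + A32) * (ENNReal.ofReal (L ^ (3 / 2 : ℝ)) * Y))
            ≤ 16 * ((K + A32 * K + B32 * K + B32 * K + A32) * (X + ENNReal.ofReal (L ^ (3 / 2 : ℝ)) * Y) +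
                (K + A32 * K + B32 * K + B32 * K + A32) * (X + ENNReal.ofReal (L ^ (3 / 2 : ℝ)) * Y)) :=
              mul_le_mul' le_rfl (add_le_add i1 i2)
          _ = 16 * (K + A32 * K + B32 * K + B32 * K + A32) * 2 * (X + ENNReal.ofReal (L ^ (3 / 2 : ℝ)) * Y) := by
              ring

end Literature.Analysis.FluidPDE

end
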